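import Summits.QuantumFields.YangMills.Theorems.LuscherReductionOneSiteLevelsValleyStatic
import Mathlib.Analysis.Complex.ExponentialBounds
import Literature.Barriers.MatrixMultiplication.NilpotentGroupBarrierPCounting

/-!
# VALLEY, step 5d: numerics for the parameter choice `B = u¹²`, `T = u⁻¹`, `w = u⁻⁵`, `δ' = u⁻⁸`, `γ = u⁻³/1000` — part A
# (support module for `stub_absUpperValleyMag` of crux `OneSiteLevels`, route `LuscherReduction`, item stmt-QuantumFields-20007;
# fleet lead prover ym-luscher-20007-p1 g2)

Elementary numerical lemmas (square roots, `e^{-5}`, `e^{±x}` for small `x`) and polynomial-in-`u⁻¹` bounds for the two error sizes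
`ε₁(u) ≤ 222 u⁻⁵`, `ε₂(u) ≤ 174 u⁻⁶` (`u ≥ 1`) of `…ValleyStatic.valley_qform_le_static`, plus the simple geometric hypotheses of that
theorem for `u ≥ 20000`.

## WHAT THIS IS NOT
Numerics only; NOT the crux, NOT THE CLAY GAP.  Sorry-free; no new definition, no named fact.
-/

set_option autoImplicit false

noncomputable section

open MeasureTheory Filter Topology Real
open scoped Matrix Quaternion RealInnerProductSpace BigOperators
open Literature.MathematicalPhysics.QuantumFieldTheory
open Literature.MathematicalPhysics.QuantumLattice
open Literature.Analysis.OperatorTheory.YMMatrixModel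

namespace Summit.QuantumFields.YangMills.Theorems.FemtoTransferGap

namespace ValleyAsymp

/-! ### §0. Numerical constants -/

/-- `2√2·√10 ≤ 9`. [folklore] -/
theorem two_sqrt_two_sqrt_ten_le : 2 * Real.sqrt 2 * Real.sqrt 10 ≤ 9 := by
  have h : Real.sqrt 2 * Real.sqrt 10 ≤ 9 / 2 := by
    rw [← Real.sqrt_mul (by norm_num), Real.sqrt_le_left (by norm_num)]; norm_num
  calc 2 * Real.sqrt 2 * Real.sqrt 10 = 2 * (Real.sqrt 2 * Real.sqrt 10) := by ring
    _ ≤ 2 * (9 / 2) := by gcongr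
    _ = 9 := by norm_num

/-- `2√2·√(1/100000) ≤ 1/100`. [folklore] -/
theorem two_sqrt_two_sqrt_small_le : 2 * Real.sqrt 2 * Real.sqrt (1 / 100000) ≤ 1 / 100 := by
  have h : Real.sqrt 2 * Real.sqrt (1 / 100000) ≤ 1 / 200 := by
    rw [← Real.sqrt_mul (by norm_num), Real.sqrt_le_left (by norm_num)]; norm_num
  calc 2 * Real.sqrt 2 * Real.sqrt (1 / 100000) = 2 * (Real.sqrt 2 * Real.sqrt (1 / 100000)) := by ring
    _ ≤ 2 * (1 / 200) := by gcongr
    _ = 1 / 100 := by norm_num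

/-- `16√2 e^{−5} ≤ 4/25`. [folklore] -/
theorem sixteen_sqrt_two_exp_neg_five_le : 16 * Real.sqrt 2 * Real.exp (-5) ≤ 4 / 25 := by
  have h2 : Real.sqrt 2 ≤ 1.4143 := by rw [Real.sqrt_le_left (by norm_num)]; norm_num
  have he : Real.exp (-5) ≤ 1 / 148 := by
    have h1 := Real.exp_one_gt_d9
    have h5 : Real.exp 5 = Real.exp 1 ^ 5 := by rw [← Real.exp_nat_mul]; norm_num
    have h148 : (148 : ℝ) ≤ Real.exp 5 := by
      rw [h5]; nlinarith [pow_le_pow_left₀ (by norm_num : (0:ℝ) ≤ 2.7182818283) h1.le 5]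
    rw [Real.exp_neg, inv_eq_one_div, div_le_div_iff_of_pos_left one_pos (Real.exp_pos _) (by norm_num)]
    exact h148
  nlinarith [Real.sqrt_nonneg 2, Real.exp_pos (-5)]

/-! ### §1. The error sizes `ε₁`, `ε₂` as functions of `u` -/

/-- `√(10/u¹²) = √10 · u⁻⁶` and `√(1/(100000 u¹²)) = √(1/100000) · u⁻⁶` (`u > 0`). [folklore] -/
theorem sqrt_div_pow_twelve {u : ℝ} (hu : 0 < u) (c : ℝ) (hc : 0 ≤ c) :
    Real.sqrt (c / u ^ 12) = Real.sqrt c * (u ^ 6)⁻¹ := by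
  rw [Real.sqrt_div hc, show u ^ 12 = (u ^ 6) ^ 2 by ring, Real.sqrt_sq (by positivity), div_eq_mul_inv]

/-- **`ε₁(u) ≤ 222 u⁻⁵`** for `u ≥ 1`. [folklore] -/
theorem eps1_le {u : ℝ} (hu : 1 ≤ u) :
    9 / 4 * (u⁻¹) ^ 8 + (1 / 2 + 1 / (8 * u⁻¹)) * (2 * Real.sqrt 2 * √(10 / u ^ 12) + 9 * (u⁻¹) ^ 8 * (2 + 36 * (u⁻¹) ^ 8))
      ≤ 222 * (u⁻¹) ^ 5 := by
  have hu0 : 0 < u := by linarith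
  set v : ℝ := u⁻¹ with hv
  have hv0 : 0 < v := by rw [hv]; positivity
  have hv1 : v ≤ 1 := by rw [hv]; exact inv_le_one_of_one_le₀ hu
  have hsq : √(10 / u ^ 12) = Real.sqrt 10 * v ^ 6 := by rw [sqrt_div_pow_twelve hu0 10 (by norm_num), hv, inv_pow]
  rw [hsq, show 1 / (8 * v) = u / 8 by rw [hv]; field_simp]
  have huv : u * v = 1 := by rw [hv]; field_simp
  have h9 : 2 * Real.sqrt 2 * (Real.sqrt 10 * v ^ 6) ≤ 9 * v ^ 6 := by
    have := two_sqrt_two_sqrt_ten_le; nlinarith [pow_pos hv0 6]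
  -- powers ≥ 5 are ≤ v⁵
  have hp6 : v ^ 6 ≤ v ^ 5 := pow_le_pow_of_le_one hv0.le hv1 (by norm_num)
  have hp8 : v ^ 8 ≤ v ^ 5 := pow_le_pow_of_le_one hv0.le hv1 (by norm_num)
  have hp16 : v ^ 16 ≤ v ^ 5 := pow_le_pow_of_le_one hv0.le hv1 (by norm_num)
  -- u·v^k = v^{k-1}
  have e6 : u * v ^ 6 = v ^ 5 := by rw [show v ^ 6 = v * v ^ 5 by ring, ← mul_assoc, huv, one_mul]
  have e8 : u * v ^ 8 = v ^ 7 := by rw [show v ^ 8 = v * v ^ 7 by ring, ← mul_assoc, huv, one_mul]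
  have e16 : u * v ^ 16 = v ^ 15 := by rw [show v ^ 16 = v * v ^ 15 by ring, ← mul_assoc, huv, one_mul]
  have hp7 : v ^ 7 ≤ v ^ 5 := pow_le_pow_of_le_one hv0.le hv1 (by norm_num)
  have hp15 : v ^ 15 ≤ v ^ 5 := pow_le_pow_of_le_one hv0.le hv1 (by norm_num)
  have hA : (1 / 2 + u / 8) * (2 * Real.sqrt 2 * (Real.sqrt 10 * v ^ 6) + 9 * v ^ 8 * (2 + 36 * v ^ 8))
      ≤ (1 / 2 + u / 8) * (9 * v ^ 6 + 18 * v ^ 8 + 324 * v ^ 16) := by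
    refine mul_le_mul_of_nonneg_left ?_ (by positivity)
    nlinarith [pow_pos hv0 8]
  have hB : (1 / 2 + u / 8) * (9 * v ^ 6 + 18 * v ^ 8 + 324 * v ^ 16)
      = 9 / 2 * v ^ 6 + 9 * v ^ 8 + 162 * v ^ 16 + 9 / 8 * (u * v ^ 6) + 9 / 4 * (u * v ^ 8) + 81 / 2 * (u * v ^ 16) := by ring
  rw [e6, e8, e16] at hB
  have hp8' : (9 / 4 : ℝ) * v ^ 8 ≤ 9 / 4 * v ^ 5 := by linarith
  calc 9 / 4 * v ^ 8 + (1 / 2 + u / 8) * (2 * Real.sqrt 2 * (Real.sqrt 10 * v ^ 6) + 9 * v ^ 8 * (2 + 36 * v ^ 8))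
      ≤ 9 / 4 * v ^ 5 + (9 / 2 * v ^ 6 + 9 * v ^ 8 + 162 * v ^ 16 + 9 / 8 * v ^ 5 + 9 / 4 * v ^ 7 + 81 / 2 * v ^ 15) := by
        rw [← hB]; exact add_le_add hp8' hA
    _ ≤ 222 * v ^ 5 := by linarith [pow_pos hv0 5]

/-- **`ε₂(u) ≤ 174 u⁻⁶`** for `u ≥ 1`. [folklore] -/
theorem eps2_le {u : ℝ} (hu : 1 ≤ u) :
    9 / 4 * (u⁻¹) ^ 8 + 1 / 2 * (2 * Real.sqrt 2 * √(1 / (100000 * u ^ 12)) + 9 * (u⁻¹) ^ 8 * (2 + 36 * (u⁻¹) ^ 8))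
      ≤ 174 * (u⁻¹) ^ 6 := by
  have hu0 : 0 < u := by linarith
  set v : ℝ := u⁻¹ with hv
  have hv0 : 0 < v := by rw [hv]; positivity
  have hv1 : v ≤ 1 := by rw [hv]; exact inv_le_one_of_one_le₀ hu
  have hsq : √(1 / (100000 * u ^ 12)) = Real.sqrt (1 / 100000) * v ^ 6 := by
    rw [show 1 / (100000 * u ^ 12) = (1 / 100000) / u ^ 12 by field_simp, sqrt_div_pow_twelve hu0 _ (by norm_num), hv, inv_pow]
  rw [hsq]
  have h9 : 2 * Real.sqrt 2 * (Real.sqrt (1 / 100000) * v ^ 6) ≤ 1 / 100 * v ^ 6 := by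
    have := two_sqrt_two_sqrt_small_le; nlinarith [pow_pos hv0 6]
  have hp8 : v ^ 8 ≤ v ^ 6 := pow_le_pow_of_le_one hv0.le hv1 (by norm_num)
  have hp16 : v ^ 16 ≤ v ^ 6 := pow_le_pow_of_le_one hv0.le hv1 (by norm_num)
  nlinarith [pow_pos hv0 8, pow_pos hv0 16]

/-! ### §2. The geometric hypotheses for `u ≥ 20000` -/

/-- `1 ≤ 2^{1/3} ≤ 2` and `bareLambda(u¹²) = 2^{1/3} u⁻⁴`. [folklore] -/
theorem bareLambda_pow_twelve {u : ℝ} (hu : 0 < u) :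
    bareLambda (u ^ 12) = (2 : ℝ) ^ ((1 : ℝ) / 3) * (u⁻¹) ^ 4 ∧ (1 : ℝ) ≤ (2 : ℝ) ^ ((1 : ℝ) / 3) ∧ (2 : ℝ) ^ ((1 : ℝ) / 3) ≤ 2 := by
  refine ⟨?_, Real.one_le_rpow (by norm_num) (by norm_num), ?_⟩
  · unfold bareLambda
    rw [Real.div_rpow (by norm_num) (by positivity)]
    have : (u ^ 12) ^ ((1 : ℝ) / 3) = u ^ 4 := by
      rw [show u ^ 12 = (u ^ 4) ^ 3 by ring, show ((u ^ 4) ^ 3 : ℝ) = (u ^ 4) ^ ((3 : ℕ) : ℝ) by rw [Real.rpow_natCast],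
        ← Real.rpow_mul (by positivity)]
      norm_num
    rw [this, inv_pow, div_eq_mul_inv]
  · calc (2 : ℝ) ^ ((1 : ℝ) / 3) ≤ (2 : ℝ) ^ (1 : ℝ) := Real.rpow_le_rpow_of_exponent_le (by norm_num) (by norm_num)
      _ = 2 := Real.rpow_one 2

/-- The valley cut radius `ρ₀ = √λ_b/2` at `B = u¹²`: `u⁻⁴/4 ≤ ρ₀²` and `ρ₀ ≤ (3/4)u⁻²`. [folklore] -/
theorem rho0_bounds {u : ℝ} (hu : 0 < u) :
    (u⁻¹) ^ 4 / 4 ≤ (Real.sqrt (bareLambda (u ^ 12)) / 2) ^ 2 ∧ Real.sqrt (bareLambda (u ^ 12)) / 2 ≤ 3 / 4 * (u⁻¹) ^ 2 := by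
  obtain ⟨hlam, h1, h2⟩ := bareLambda_pow_twelve hu
  have hv : 0 < (u⁻¹) ^ 4 := by positivity
  have hlam0 : 0 ≤ bareLambda (u ^ 12) := by rw [hlam]; positivity
  constructor
  · rw [div_pow, Real.sq_sqrt hlam0, hlam]; nlinarith
  · have : Real.sqrt (bareLambda (u ^ 12)) ≤ 3 / 2 * (u⁻¹) ^ 2 := by
      rw [Real.sqrt_le_left (by positivity), hlam]; nlinarith
    linarith

/-- **Geometric hypotheses** of `valley_qform_le_static` at `B = u¹²`, `T = u⁻¹`, `w = u⁻⁵`, `ρ₀ = √λ_b/2`, `δ' = u⁻⁸`,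
`J = ⌊u⁴/2⌋`, for `u ≥ 20000`. [folklore] -/
theorem geom_hyps {u : ℝ} (hu : 20000 ≤ u) :
    54 ≤ u ^ 12 ∧ u⁻¹ + 1 / 8 ≤ 7 / 50 ∧ 0 < (u⁻¹) ^ 5 ∧ 0 < Real.sqrt (bareLambda (u ^ 12)) / 2
      ∧ Real.sqrt (bareLambda (u ^ 12)) / 2 + (u⁻¹) ^ 5 ≤ u⁻¹ ∧ 0 < ⌊u ^ 4 / 2⌋₊
      ∧ u⁻¹ + 2 * (⌊u ^ 4 / 2⌋₊ : ℕ) * (u⁻¹) ^ 5 ≤ 2 * u⁻¹ ∧ 0 < (u⁻¹) ^ 8 ∧ (u⁻¹) ^ 8 ≤ 1 / 72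
      ∧ (u⁻¹) ^ 3 / 1000 ≤ 1 ∧ (1 : ℝ) / ⌊u ^ 4 / 2⌋₊ ≤ (u⁻¹) ^ 3 / 4000 := by
  have hu0 : 0 < u := by linarith
  have hv0 : 0 < u⁻¹ := by positivity
  have hvle : u⁻¹ ≤ 1 / 20000 := by rw [inv_eq_one_div]; exact one_div_le_one_div_of_le (by norm_num) hu
  have hv1 : u⁻¹ ≤ 1 := by linarith
  have huv : u * u⁻¹ = 1 := by field_simp
  obtain ⟨hρsq, hρle⟩ := rho0_bounds hu0
  obtain ⟨hlam, h21, _⟩ := bareLambda_pow_twelve hu0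
  have hρpos : 0 < Real.sqrt (bareLambda (u ^ 12)) / 2 := by
    have : 0 < bareLambda (u ^ 12) := by rw [hlam]; positivity
    have := Real.sqrt_pos.2 this
    linarith
  have hu4 : (4 : ℝ) ≤ u ^ 4 := le_trans (by norm_num) (pow_le_pow_left₀ (by norm_num) hu 4)
  have hfloor_le : (⌊u ^ 4 / 2⌋₊ : ℝ) ≤ u ^ 4 / 2 := Nat.floor_le (by positivity)
  have hfloor_pos : 0 < ⌊u ^ 4 / 2⌋₊ := Nat.floor_pos.2 (by linarith)
  have hfloor_ge : u ^ 4 / 4 ≤ (⌊u ^ 4 / 2⌋₊ : ℝ) := by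
    have := Nat.sub_one_lt_floor (u ^ 4 / 2)
    linarith
  have hp5 : (u⁻¹) ^ 5 ≤ (u⁻¹) ^ 2 := pow_le_pow_of_le_one hv0.le hv1 (by norm_num)
  have hp8 : (u⁻¹) ^ 8 ≤ (u⁻¹) ^ 1 := pow_le_pow_of_le_one hv0.le hv1 (by norm_num)
  have hp3 : (u⁻¹) ^ 3 ≤ (u⁻¹) ^ 1 := pow_le_pow_of_le_one hv0.le hv1 (by norm_num)
  have hv2 : (u⁻¹) ^ 2 ≤ u⁻¹ * (1 / 20000) := by rw [sq]; exact mul_le_mul_of_nonneg_left hvle hv0.le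
  refine ⟨le_trans (by norm_num) (pow_le_pow_left₀ (by norm_num) hu 12), by linarith, by positivity, hρpos, ?_, hfloor_pos, ?_,
    by positivity, by rw [pow_one] at hp8; linarith, by rw [pow_one] at hp3; linarith, ?_⟩
  · nlinarith
  · -- u⁻¹ + 2⌊u⁴/2⌋ u⁻⁵ ≤ 2u⁻¹, from ⌊u⁴/2⌋ ≤ u⁴/2 and u⁴ u⁻⁵ = u⁻¹
    have e : u ^ 4 * (u⁻¹) ^ 5 = u⁻¹ := by field_simp
    have := mul_le_mul_of_nonneg_right hfloor_le (by positivity : (0:ℝ) ≤ (u⁻¹) ^ 5)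
    nlinarith
  · -- 1/⌊u⁴/2⌋ ≤ 4 u⁻⁴ ≤ u⁻³/4000
    have h1 : (1 : ℝ) / ⌊u ^ 4 / 2⌋₊ ≤ 4 * (u⁻¹) ^ 4 := by
      rw [div_le_iff₀ (by exact_mod_cast hfloor_pos)]
      have e : (u⁻¹) ^ 4 * u ^ 4 = 1 := by field_simp
      nlinarith [mul_le_mul_of_nonneg_left hfloor_ge (by positivity : (0:ℝ) ≤ 4 * (u⁻¹) ^ 4)]
    have h2 : (u⁻¹) ^ 4 ≤ (u⁻¹) ^ 3 * (1 / 20000) := by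
      rw [show (u⁻¹) ^ 4 = (u⁻¹) ^ 3 * u⁻¹ by ring]; exact mul_le_mul_of_nonneg_left hvle (by positivity)
    have h3 : 0 ≤ (u⁻¹) ^ 3 := by positivity
    linarith

/-! ### §3. The analytic hypotheses for `u ≥ 20000` -/

/-- `512 e^{−u⁴/4} ≤ 16384 u⁻⁸` (from `e^{x} ≥ x²/2`). [folklore] -/
theorem tail512_le {u : ℝ} (hu : 0 < u) : 512 * Real.exp (-(u ^ 12 * (u⁻¹) ^ 8 / 4)) ≤ 16384 * (u⁻¹) ^ 8 := by
  have e : u ^ 12 * (u⁻¹) ^ 8 / 4 = u ^ 4 / 4 := by field_simp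
  rw [e]
  have h := Real.pow_div_factorial_le_exp (u ^ 4 / 4) (by positivity) 2
  rw [show Nat.factorial 2 = 2 by rfl] at h
  push_cast at h
  have hx : 0 < (u ^ 4 / 4) ^ 2 / 2 := by positivity
  rw [Real.exp_neg]
  have h1 : (Real.exp (u ^ 4 / 4))⁻¹ ≤ ((u ^ 4 / 4) ^ 2 / 2)⁻¹ := by
    rw [inv_le_inv₀ (Real.exp_pos _) hx]; exact h
  have h2 : ((u ^ 4 / 4) ^ 2 / 2)⁻¹ = 32 * (u⁻¹) ^ 8 := by field_simp; ring
  linarith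

/-- `(1 + a)(1 − b) ≤ 1 + a − b` for `a, b ≥ 0`. [folklore] -/
theorem one_add_mul_one_sub_le {a b : ℝ} (ha : 0 ≤ a) (hb : 0 ≤ b) : (1 + a) * (1 - b) ≤ 1 + a - b := by
  nlinarith [mul_nonneg ha hb]

/-- `(1 − a)(1 − b) ≥ 1 − a − b` for `a, b ≥ 0`. [folklore] -/
theorem one_sub_mul_one_sub_ge {a b : ℝ} (ha : 0 ≤ a) (hb : 0 ≤ b) : 1 - a - b ≤ (1 - a) * (1 - b) := by nlinarith

/-- Small-power bookkeeping for `0 < v ≤ 1/20000`. [folklore] -/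
theorem small_powers {v : ℝ} (hv0 : 0 < v) (hvle : v ≤ 1 / 20000) :
    v ^ 2 ≤ 1 / 400000000 ∧ v ^ 3 ≤ v ^ 2 ∧ v ^ 5 ≤ v ^ 3 * (1 / 400000000) ∧ v ^ 8 ≤ v ^ 3 * (1 / 400000000)
    ∧ v ^ 11 ≤ v ^ 3 * (1 / 400000000) ∧ v ^ 12 ≤ v ^ 3 * (1 / 400000000) ∧ v ^ 3 ≤ v ^ 2 * (1 / 20000)
    ∧ v ^ 6 ≤ v ^ 2 * (1 / 400000000) ∧ v ^ 8 ≤ v ^ 2 * (1 / 400000000) ∧ v ^ 10 ≤ v ^ 2 * (1 / 400000000)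
    ∧ v ^ 12 ≤ v ^ 2 * (1 / 400000000)
    ∧ 1 - 27 * v ^ 12 - v ^ 3 / 1000 ≤ (1 - 27 * v ^ 12) * (1 - v ^ 3 / 1000) ∧ 0 ≤ 1 - 36 * v ^ 8 := by
  have hv1 : v ≤ 1 := by linarith
  have hv2 : v ^ 2 ≤ 1 / 400000000 := by nlinarith
  have hp3 : v ^ 3 ≤ v ^ 2 := pow_le_pow_of_le_one hv0.le hv1 (by norm_num)
  have hq5 : v ^ 5 ≤ v ^ 3 * (1 / 400000000) := by
    rw [show v ^ 5 = v ^ 3 * v ^ 2 by ring]; exact mul_le_mul_of_nonneg_left hv2 (by positivity)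
  have hr3 : v ^ 3 ≤ v ^ 2 * (1 / 20000) := by
    rw [show v ^ 3 = v ^ 2 * v by ring]; exact mul_le_mul_of_nonneg_left hvle (by positivity)
  have hr6 : v ^ 6 ≤ v ^ 2 * (1 / 400000000) := by
    rw [show v ^ 6 = v ^ 2 * v ^ 4 by ring]
    exact mul_le_mul_of_nonneg_left (le_trans (pow_le_pow_of_le_one hv0.le hv1 (by norm_num : 2 ≤ 4)) hv2) (by positivity)
  have hp8 : v ^ 8 ≤ v ^ 2 := pow_le_pow_of_le_one hv0.le hv1 (by norm_num)
  refine ⟨hv2, hp3, hq5, le_trans (pow_le_pow_of_le_one hv0.le hv1 (by norm_num : 5 ≤ 8)) hq5,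
    le_trans (pow_le_pow_of_le_one hv0.le hv1 (by norm_num : 5 ≤ 11)) hq5,
    le_trans (pow_le_pow_of_le_one hv0.le hv1 (by norm_num : 5 ≤ 12)) hq5, hr3, hr6,
    le_trans (pow_le_pow_of_le_one hv0.le hv1 (by norm_num : 6 ≤ 8)) hr6,
    le_trans (pow_le_pow_of_le_one hv0.le hv1 (by norm_num : 6 ≤ 10)) hr6,
    le_trans (pow_le_pow_of_le_one hv0.le hv1 (by norm_num : 6 ≤ 12)) hr6,
    one_sub_mul_one_sub_ge (by positivity) (by positivity), by nlinarith⟩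

/-- **Analytic hypothesis `h1a`** at the parameter choice, `u ≥ 20000`. [folklore] -/
theorem hyp_h1a {u : ℝ} (hu : 20000 ≤ u) :
    16 * Real.sqrt 2 * Real.exp (-5) ≤ (1 - 27 / u ^ 12) * (1 - (u⁻¹) ^ 3 / 1000) := by
  have hu0 : 0 < u := by linarith
  rw [show 27 / u ^ 12 = 27 * (u⁻¹) ^ 12 by rw [inv_pow, div_eq_mul_inv]]
  have hvle : u⁻¹ ≤ 1 / 20000 := by rw [inv_eq_one_div]; exact one_div_le_one_div_of_le (by norm_num) hu
  obtain ⟨hv2, hp3, _, _, _, hq12, _, _, _, _, _, hR, _⟩ := small_powers (inv_pos.2 hu0) hvle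
  linarith [sixteen_sqrt_two_exp_neg_five_le, pow_pos (inv_pos.2 hu0) 3]

/-- **Analytic hypothesis `h1b`** (shell-1 NEAR gain beats the errors), `u ≥ 20000`. [folklore] -/
theorem hyp_h1b {u : ℝ} (hu : 20000 ≤ u) :
    (1 + 18 * (9 / 4 * (u⁻¹) ^ 8 + (1 / 2 + 1 / (8 * u⁻¹)) * (2 * Real.sqrt 2 * √(10 / u ^ 12)
          + 9 * (u⁻¹) ^ 8 * (2 + 36 * (u⁻¹) ^ 8))))
        * (1 - 5 / 16 * min (1 / (16 * u⁻¹) * (1 - 36 * (u⁻¹) ^ 8) * (Real.sqrt (bareLambda (u ^ 12)) / 2) ^ 2) (1 / 500))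
        + 512 * Real.exp (-(u ^ 12 * (u⁻¹) ^ 8 / 4)) ≤ (1 - 27 / u ^ 12) * (1 - (u⁻¹) ^ 3 / 1000) := by
  have hu0 : 0 < u := by linarith
  have hu1 : 1 ≤ u := by linarith
  have hε₁ := eps1_le hu1
  have htail := tail512_le hu0
  obtain ⟨hρsq, _⟩ := rho0_bounds hu0
  have e27 : 27 / u ^ 12 = 27 * (u⁻¹) ^ 12 := by rw [inv_pow, div_eq_mul_inv]
  have e16 : 1 / (16 * u⁻¹) = u / 16 := by field_simp
  have e8 : 1 / (8 * u⁻¹) = u / 8 := by field_simp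
  rw [e27, e16, e8]
  rw [e8] at hε₁
  set v : ℝ := u⁻¹ with hv
  have hv0 : 0 < v := by rw [hv]; positivity
  have hvle : v ≤ 1 / 20000 := by rw [hv, inv_eq_one_div]; exact one_div_le_one_div_of_le (by norm_num) hu
  have huv : u * v = 1 := by rw [hv]; field_simp
  clear_value v
  obtain ⟨hv2, hp3, hq5, hq8, hq11, hq12, _, _, _, _, _, hR, h36⟩ := small_powers hv0 hvle
  have hv3pos : 0 < v ^ 3 := pow_pos hv0 3
  have ha0 : 0 ≤ (1 - 36 * v ^ 8) * v ^ 3 / 64 := div_nonneg (mul_nonneg h36 hv3pos.le) (by norm_num)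
  have ha' : (1 - 36 * v ^ 8) * v ^ 3 / 64 ≤ 1 / 500 := by
    have : v ^ 3 ≤ 1 := le_trans hp3 (by linarith)
    nlinarith [pow_pos hv0 8]
  have huv4 : u * v ^ 4 = v ^ 3 := by rw [show v ^ 4 = v * v ^ 3 by ring, ← mul_assoc, huv, one_mul]
  have hmin : (1 - 36 * v ^ 8) * v ^ 3 / 64 ≤ min (u / 16 * (1 - 36 * v ^ 8) * (Real.sqrt (bareLambda (u ^ 12)) / 2) ^ 2) (1 / 500) := by
    refine le_min ?_ ha'
    have e3 : (1 - 36 * v ^ 8) * v ^ 3 / 64 = u / 16 * (1 - 36 * v ^ 8) * (v ^ 4 / 4) := by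
      rw [show u / 16 * (1 - 36 * v ^ 8) * (v ^ 4 / 4) = (1 - 36 * v ^ 8) * (u * v ^ 4) / 64 by ring, huv4]
    rw [e3]
    exact mul_le_mul_of_nonneg_left hρsq (by positivity)
  obtain ⟨E, hE⟩ : ∃ E : ℝ, E = 9 / 4 * v ^ 8 + (1 / 2 + u / 8) * (2 * Real.sqrt 2 * √(10 / u ^ 12) + 9 * v ^ 8 * (2 + 36 * v ^ 8)) :=
    ⟨_, rfl⟩
  have hE0 : 0 ≤ E := by rw [hE]; positivity
  have hE' : E ≤ 222 * v ^ 5 := by rw [hE]; exact hε₁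
  obtain ⟨m, hm⟩ : ∃ m : ℝ, m = min (u / 16 * (1 - 36 * v ^ 8) * (Real.sqrt (bareLambda (u ^ 12)) / 2) ^ 2) (1 / 500) := ⟨_, rfl⟩
  rw [← hm] at hmin
  have hm0 : 0 ≤ m := le_trans ha0 hmin
  rw [← hE, ← hm]
  have hprod : (1 + 18 * E) * (1 - 5 / 16 * m) ≤ 1 + 18 * E - 5 / 16 * m :=
    one_add_mul_one_sub_le (by linarith only [hE0]) (by linarith only [hm0])
  have ea : 5 / 16 * ((1 - 36 * v ^ 8) * v ^ 3 / 64) = 5 / 1024 * v ^ 3 - 180 / 1024 * v ^ 11 := by ring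
  linarith only [hprod, hmin, hE', htail, hR, hq5, hq8, hq11, hq12, hv3pos, ea]

/-- **Analytic hypothesis `h2a`** (shell-2 FAR), `u ≥ 20000`. [folklore] -/
theorem hyp_h2a {u : ℝ} (hu : 20000 ≤ u) :
    Real.exp (-(1 / 200000)) ≤ (1 - 27 / u ^ 12) * (1 - (u⁻¹) ^ 3 / 1000) := by
  have hu0 : 0 < u := by linarith
  rw [show 27 / u ^ 12 = 27 * (u⁻¹) ^ 12 by rw [inv_pow, div_eq_mul_inv]]
  have hvle : u⁻¹ ≤ 1 / 20000 := by rw [inv_eq_one_div]; exact one_div_le_one_div_of_le (by norm_num) hu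
  obtain ⟨hv2, hp3, _, _, _, hq12, hr3, _, _, _, _, hR, _⟩ := small_powers (inv_pos.2 hu0) hvle
  have h := GaussNear.exp_neg_le_taylor (x := 1 / 200000) (by norm_num) (by norm_num)
  linarith only [h, hR, hq12, pow_pos (inv_pos.2 hu0) 3, hr3, hv2]

/-- **Analytic hypothesis `h2b`** (shell-2 NEAR, inner region), `u ≥ 20000`. [folklore] -/
theorem hyp_h2b {u : ℝ} (hu : 20000 ≤ u) :
    (1 + 18 * (9 / 4 * (u⁻¹) ^ 8 + 1 / 2 * (2 * Real.sqrt 2 * √(1 / (100000 * u ^ 12)) + 9 * (u⁻¹) ^ 8 * (2 + 36 * (u⁻¹) ^ 8))))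
        * (1 - 5 / 16 * min (1 / 2 * (1 - 36 * (u⁻¹) ^ 8) * (u⁻¹) ^ 2) (1 / 500)) + 512 * Real.exp (-(u ^ 12 * (u⁻¹) ^ 8 / 4))
      ≤ (1 - 27 / u ^ 12) * (1 - (u⁻¹) ^ 3 / 1000) := by
  have hu0 : 0 < u := by linarith
  have hu1 : 1 ≤ u := by linarith
  have hε₂ := eps2_le hu1
  have htail := tail512_le hu0
  rw [show 27 / u ^ 12 = 27 * (u⁻¹) ^ 12 by rw [inv_pow, div_eq_mul_inv]]
  set v : ℝ := u⁻¹ with hv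
  have hv0 : 0 < v := by rw [hv]; positivity
  have hvle : v ≤ 1 / 20000 := by rw [hv, inv_eq_one_div]; exact one_div_le_one_div_of_le (by norm_num) hu
  clear_value v
  obtain ⟨hv2, _, _, _, _, _, hr3, hr6, hr8, hr10, hr12, hR, h36⟩ := small_powers hv0 hvle
  have hv2pos : 0 < v ^ 2 := pow_pos hv0 2
  have ha2 : 1 / 2 * (1 - 36 * v ^ 8) * v ^ 2 ≤ 1 / 500 := by
    have : (1 - 36 * v ^ 8) * v ^ 2 ≤ 1 * v ^ 2 := mul_le_mul_of_nonneg_right (by linarith only [pow_pos hv0 8]) hv2pos.le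
    linarith only [this, hv2]
  have hg0 : 0 ≤ 1 / 2 * (1 - 36 * v ^ 8) * v ^ 2 := mul_nonneg (mul_nonneg (by norm_num) h36) hv2pos.le
  obtain ⟨m, hm⟩ : ∃ m : ℝ, m = min (1 / 2 * (1 - 36 * v ^ 8) * v ^ 2) (1 / 500) := ⟨_, rfl⟩
  have hmin : 1 / 2 * (1 - 36 * v ^ 8) * v ^ 2 ≤ m := by rw [hm]; exact le_min (le_refl _) ha2
  rw [← hm]
  have hm0 : 0 ≤ m := le_trans hg0 hmin
  obtain ⟨E, hE⟩ : ∃ E : ℝ, E = 9 / 4 * v ^ 8 + 1 / 2 * (2 * Real.sqrt 2 * √(1 / (100000 * u ^ 12)) + 9 * v ^ 8 * (2 + 36 * v ^ 8)) :=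
    ⟨_, rfl⟩
  have hE0 : 0 ≤ E := by rw [hE]; positivity
  have hE' : E ≤ 174 * v ^ 6 := by rw [hE]; exact hε₂
  rw [← hE]
  have hprod : (1 + 18 * E) * (1 - 5 / 16 * m) ≤ 1 + 18 * E - 5 / 16 * m :=
    one_add_mul_one_sub_le (by linarith only [hE0]) (by linarith only [hm0])
  have ea : 5 / 16 * (1 / 2 * (1 - 36 * v ^ 8) * v ^ 2) = 5 / 32 * v ^ 2 - 45 / 8 * v ^ 10 := by ring
  linarith only [hprod, hmin, hE', htail, hR, hr3, hr6, hr8, hr10, hr12, hv2pos, ea]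

/-- **Analytic hypothesis `h2c`** (shell-2 NEAR, outer region), `u ≥ 20000`. [folklore] -/
theorem hyp_h2c {u : ℝ} (hu : 20000 ≤ u) :
    (1 + 18 * (9 / 4 * (u⁻¹) ^ 8 + 1 / 2 * (2 * Real.sqrt 2 * √(1 / (100000 * u ^ 12)) + 9 * (u⁻¹) ^ 8 * (2 + 36 * (u⁻¹) ^ 8))))
        * Real.exp ((27 / 4 + 9 * (u⁻¹) ^ 8) / 100000) * (1 - 5 / 16 * (1 / 500)) + 512 * Real.exp (-(u ^ 12 * (u⁻¹) ^ 8 / 4))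
      ≤ (1 - 27 / u ^ 12) * (1 - (u⁻¹) ^ 3 / 1000) := by
  have hu0 : 0 < u := by linarith
  have hu1 : 1 ≤ u := by linarith
  have hε₂ := eps2_le hu1
  have htail := tail512_le hu0
  rw [show 27 / u ^ 12 = 27 * (u⁻¹) ^ 12 by rw [inv_pow, div_eq_mul_inv]]
  set v : ℝ := u⁻¹ with hv
  have hv0 : 0 < v := by rw [hv]; positivity
  have hvle : v ≤ 1 / 20000 := by rw [hv, inv_eq_one_div]; exact one_div_le_one_div_of_le (by norm_num) hu
  clear_value v
  obtain ⟨hv2, _, _, hq8, _, hq12, hr3, hr6, hr8, _, _, hR, _⟩ := small_powers hv0 hvle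
  have hv3pos : 0 < v ^ 3 := pow_pos hv0 3
  obtain ⟨E, hE⟩ : ∃ E : ℝ, E = 9 / 4 * v ^ 8 + 1 / 2 * (2 * Real.sqrt 2 * √(1 / (100000 * u ^ 12)) + 9 * v ^ 8 * (2 + 36 * v ^ 8)) :=
    ⟨_, rfl⟩
  have hE' : E ≤ 174 * v ^ 6 := by rw [hE]; exact hε₂
  rw [← hE]
  have hE1 : 1 + 18 * E ≤ 1 + 1 / 100000 := by linarith only [hE', hr6, hv2]
  obtain ⟨x, hxdef⟩ : ∃ x : ℝ, x = (27 / 4 + 9 * v ^ 8) / 100000 := ⟨_, rfl⟩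
  rw [← hxdef]
  have hx : x ≤ 7 / 100000 := by rw [hxdef]; linarith only [hr8, hv2]
  have hx0 : 0 ≤ x := by rw [hxdef]; positivity
  have hexp : Real.exp x ≤ 1 + 7 / 100000 + (7 / 100000) ^ 2 := by
    refine (Literature.Barriers.MatrixMultiplication.exp_le_one_add_add_sq (by rw [abs_of_nonneg hx0]; linarith only [hx])).trans ?_
    have := pow_le_pow_left₀ hx0 hx 2
    linarith only [this, hx]
  have ha : (0:ℝ) ≤ 1 + 1 / 100000 := by norm_num
  have hb : (0:ℝ) ≤ 1 - 5 / 16 * (1 / 500) := by norm_num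
  have h1 : (1 + 18 * E) * Real.exp x * (1 - 5 / 16 * (1 / 500))
      ≤ (1 + 1 / 100000) * (1 + 7 / 100000 + (7 / 100000) ^ 2) * (1 - 5 / 16 * (1 / 500)) :=
    mul_le_mul_of_nonneg_right (mul_le_mul hE1 hexp (Real.exp_pos x).le ha) hb
  have hnum : (1 + 1 / 100000 : ℝ) * (1 + 7 / 100000 + (7 / 100000) ^ 2) * (1 - 5 / 16 * (1 / 500)) ≤ 9995 / 10000 := by
    norm_num
  linarith only [h1, hnum, htail, hR, hq8, hq12, hr3, hv2, hv3pos]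

end ValleyAsymp

end Summit.QuantumFields.YangMills.Theorems.FemtoTransferGap

end
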